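import Summits.QuantumFields.YangMills.Theorems.BalabanUVNodesN09AtRecord
import Literature.MathematicalPhysics.QuantumFieldTheory.Balaban1983to89.B12NodeKnitRecord11
import Literature.MathematicalPhysics.QuantumFieldTheory.Balaban1983to89.Node00.Record11Carriers

/-!
# BalabanUVNodes ∕ N09 at the STAGE-11 record `Node00.IsRecordOfRecord₁₁C` — the ₁₁C instances of N09's (W2) closers of record
# (`BalabanUVNodesN09AtRecord`): by the SHADOW for the Stage-5 sockets (plan's (W2′)(ii)), and Stage-11-NATIVE from the [B11] binders ALONE
# (Track A, DAG node N09 [Balaban1987RG1]; KNIT-BY-NAME seat `pub-ymgap-dag-n09-d` g0, strategy s2, director-ym R134; def-T's `Node00/Record11.lean`, 2026-08-26)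

HONEST FRAMING.  Count-neutral kernel bookkeeping over landed modules BY NAME: `BalabanUVNodesN09AtRecord.s_N09_of_shadow₅C` ∕ `guards_of_isRecordOfRecord₅C` ∕
`b12_main_iff_of_isRecordOfRecord₅C`, `Node00.exists_isRecordOfRecord₅C_of_isRecordOfRecord₁₁C` ∕ `atWorld_of_isRecordOfRecord₁₁C` (the ₁₁C → ₅C-at-the-shadow
refinement, same world), `B12NodeKnitRecord11.b12_main_at_record₁₁C_of_leaf` (the Stage-11-native knit, MODULE 3′), `Node00.isRecordOfRecord₁₁C_of_isRecordOfRecord₁₁CB10YZW`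
(node00-def g31's four-pin refinement, same datum and world).  The route `BalabanUVNodes` was RESTATED at ₁₁C (rev 6, T-day 2026-08-26): K1 `StabilityBAtRecordR11e`
(stmt-QuantumFields-19674) reads `Node00.IsRecordOfRecord₁₁C F 2`; this file is N09's member of the `Nodes` conjunction AT THAT RECORD CLASS.  NOT a discharge of N09:
the sockets ∕ binders are the B12-group pin (conjunct 1, node00-def's object `Node00/CarriersB12`, not in tree) and, for the member, [B11] Thm 1 at the record's
domains ((1.1), `HRestrict`, intermediate uniqueness — N07's content); the composition ∕ invariance clauses are theorems since ₁₀ (`B12ContinuousTransportInvariance`,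
`B12NodeKnitContinuousTransport`) fed by the record's own proviso `Provisos₁₁.base.contT`.  The ₁₁ pins (`S218OfRecord₁₁`, `ScorrLawOfRecord₁₁`) concern the 𝐑-leaf and
the core's `Sect2Form` clause (N11 ∕ N13), NOT N09 — the binder census at ₁₁C IS the ₁₀C census.  `IsRecordOfRecord₁₁C` is NOT yet known inhabited (K0
`Record11Inhabited`, stmt-QuantumFields-19673).  Nothing of Bałaban's asserted; one finite four-torus programme at fixed ε; nothing continuum ∕ ℝ⁴ ∕ OS ∕
mass-gap ∕ Clay.  0 `sorry`, 0 `def`, standard axioms.  Filed `--supports` K1 `StabilityBAtRecordR11e` (stmt-QuantumFields-19674).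

WHAT THIS FILE PROVES.  `s_N09_rec₁₁C_of_sockets₅` (the two Stage-5 sockets over the SHADOW records ⇒ `S_N09 (IsRecordOfRecord₁₁C)`); `s_N09_of_refines₁₁C` ∕
`s_N09_rec₁₁C` ∕ `s_N09_rec₁₁CB10YZW` (every `Rec` refining ₁₁C ∕ ₁₁C itself ∕ g31's four-pin record, from the pin at the presenting Stage-11 parameters + (1.1) on
the domains + `HRestrict` + intermediate uniqueness — NO composition binder); `guards_of_isRecordOfRecord₁₁C` (in-edges `b4 b5 b6 b7` HOLD at ₁₁C),
`b12_main_iff_of_isRecordOfRecord₁₁C` (N09 at ₁₁C ⇔ «b8 → b9 → b10 → b11 → (b12 ∧ member)»), `forall_b12_main_of_isRecordOfRecord₁₁C` (the `Nodes`-conjunct form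
`∀ P, Dag.B12_main (leavesP w P)` AT ONE ₁₁C record — the shape K1's ∃-form consumes).
-/

noncomputable section

namespace Summit.QuantumFields.YangMills.BalabanUVNodes.N09AtRecord11

open Literature.MathematicalPhysics.QuantumFieldTheory.Balaban1983to89
open Literature.MathematicalPhysics.QuantumFieldTheory.Balaban1983to89.T4Continuum (T4Family FiniteEpsData)
open Literature.MathematicalPhysics.QuantumFieldTheory.Balaban1983to89.DagBinding (WorldP leavesP)
open Literature.MathematicalPhysics.QuantumFieldTheory.Balaban1983to89.Node00
open YMDAG.UVSplit (RecordPred Datum AtRecord S_N09)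
open Summit.QuantumFields.YangMills.BalabanUVNodes.N09AtRecord
  (s_N09_of_shadow₅C guards_of_isRecordOfRecord₅C b12_main_iff_of_isRecordOfRecord₅C)

variable {N : ℕ} [NeZero N]

/-! ## §1. `S_N09` at ₁₁C by the shadow (Stage-5 sockets) -/

/-- **`S_N09` AT THE STAGE-11 RECORD from the two Stage-5 sockets OVER THE SHADOW RECORDS** (plan's (W2′)(ii): `s_N09_of_shadow₅C` at
`Node00.exists_isRecordOfRecord₅C_of_isRecordOfRecord₁₁C`). [cite: Balaban1987RG1, Lemma 4 (3.53) p.280, Thm 1 p.259 and Thm 3 p.264] -/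
theorem s_N09_rec₁₁C_of_sockets₅
    (slot12 : ∀ (F : T4Family) (D₅ : Datum F N) (w : WorldP), IsRecordOfRecord₅C F N D₅ w →
      ∀ θ : Stage5Params F N, θ.Admissible → D₅ = datumOfRecord₅ F N θ → (∀ P, w.up P = upOfRecord₅C F N θ P) →
        ∀ P : B12.RunParams, B12Sec2to5.Lemma4Printed (θ.res.X P).F12 (θ.res.X P).c12)
    (slotT : ∀ (F : T4Family) (D₅ : Datum F N) (w : WorldP), IsRecordOfRecord₅C F N D₅ w →
      ∀ θ : Stage5Params F N, θ.Admissible → D₅ = datumOfRecord₅ F N θ → w.C = D₅.C → w.γ = θ.γ → ∀ P : B12.RunParams,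
        ((datumOfRecord₅ F N θ).C P).flow.InInterval θ.γ P.K → ∀ k, k ≤ P.K → ((datumOfRecord₅ F N θ).C P).IndAss k) :
    S_N09 (fun F D w => IsRecordOfRecord₁₁C F N D w) :=
  s_N09_of_shadow₅C _ (fun F _ _ h => (exists_isRecordOfRecord₅C_of_isRecordOfRecord₁₁C (F := F) h).imp fun _ h5 => h5.1) slot12 slotT

/-! ## §2. `S_N09` at ₁₁C, Stage-11-native (pin slot + [B11] binders over the presenting parameters) -/

/-- **`S_N09 Rec` FOR EVERY RECORD PREDICATE REFINING THE STAGE-11 RECORD**, Stage-11-native, from the pin slot and the [B11] binders over the presenting Stage-11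
parameters and their provisos — (1.1) on the domains, `HRestrict`, intermediate uniqueness; NO composition ∕ invariance binder
(`B12NodeKnitRecord11.b12_main_at_record₁₁C_of_leaf` BY NAME). [cite: Balaban1987RG1, Lemma 4 (3.53) p.280, Thm 3 p.264, (1.1)–(1.3) p.260 and (2.16) p.269; Balaban1985Variational, Thm 1 (8)–(10) p.279] -/
theorem s_N09_of_refines₁₁C (Rec : RecordPred N)
    (href : ∀ (F : T4Family) (D : Datum F N) (w : WorldP), Rec F D w → IsRecordOfRecord₁₁C F N D w)
    (slot12 : ∀ (F : T4Family) (D : Datum F N) (w : WorldP), Rec F D w →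
      ∀ θ : Stage11Params F N, ∀ h : θ.Provisos₁₁, θ.Admissible → D = datumOfRecord₁₁ F N θ h → w.γ ≤ θ.γ →
        (∀ P, w.up P = upOfRecord₅C F N (θ.toStage5₁₁ F N) P) → ∀ P : B12.RunParams, B12Sec2to5.Lemma4Printed (θ.res.X P).F12 (θ.res.X P).c12)
    (h11 : ∀ (F : T4Family) (D : Datum F N) (w : WorldP), Rec F D w →
      ∀ θ : Stage11Params F N, ∀ h : θ.Provisos₁₁, θ.Admissible → D = datumOfRecord₁₁ F N θ h → w.γ ≤ θ.γ →
        ∀ (p : B12.RunParams) (k : ℕ), k ≤ p.K →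
          ∀ V ∈ domAltOfRecord F N θ.ν p.K k, UkExists F N p.K k θ.εbg V ∧ UniqueUkOrbit F N p.K k θ.εbg V)
    (hres : ∀ (F : T4Family) (D : Datum F N) (w : WorldP), Rec F D w →
      ∀ θ : Stage11Params F N, ∀ h : θ.Provisos₁₁, θ.Admissible → D = datumOfRecord₁₁ F N θ h → w.γ ≤ θ.γ →
        ∀ (p : B12.RunParams) (k : ℕ), k ≤ p.K → HRestrict F N θ.εbg p.K k (domAltOfRecord F N θ.ν p.K k))
    (huniq : ∀ (F : T4Family) (D : Datum F N) (w : WorldP), Rec F D w →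
      ∀ θ : Stage11Params F N, ∀ h : θ.Provisos₁₁, θ.Admissible → D = datumOfRecord₁₁ F N θ h → w.γ ≤ θ.γ →
        ∀ (p : B12.RunParams) (k : ℕ), k ≤ p.K → ∀ V ∈ domAltOfRecord F N θ.ν p.K k, ∀ j < k,
          UniqueUkOrbit F N p.K (j + 1) θ.εbg (Averaging.iter (avOfRecord F N p.K) (j + 1) (Uk F N p.K k θ.εbg V))) :
    S_N09 Rec :=
  fun F D w hR P =>
    B12NodeKnitRecord11.b12_main_at_record₁₁C_of_leaf (href F D w hR) (slot12 F D w hR) (h11 F D w hR) (hres F D w hR) (huniq F D w hR) P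

/-- **`S_N09` AT THE STAGE-11 RECORD ITSELF** from the pin slot and the [B11] binders. [cite: Balaban1987RG1, Lemma 4 (3.53) p.280, Thm 3 p.264 and (1.1)–(1.3) p.260; Balaban1985Variational, Thm 1 p.279] -/
theorem s_N09_rec₁₁C
    (slot12 : ∀ (F : T4Family) (D : Datum F N) (w : WorldP), IsRecordOfRecord₁₁C F N D w →
      ∀ θ : Stage11Params F N, ∀ h : θ.Provisos₁₁, θ.Admissible → D = datumOfRecord₁₁ F N θ h → w.γ ≤ θ.γ →
        (∀ P, w.up P = upOfRecord₅C F N (θ.toStage5₁₁ F N) P) → ∀ P : B12.RunParams, B12Sec2to5.Lemma4Printed (θ.res.X P).F12 (θ.res.X P).c12)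
    (h11 : ∀ (F : T4Family) (D : Datum F N) (w : WorldP), IsRecordOfRecord₁₁C F N D w →
      ∀ θ : Stage11Params F N, ∀ h : θ.Provisos₁₁, θ.Admissible → D = datumOfRecord₁₁ F N θ h → w.γ ≤ θ.γ →
        ∀ (p : B12.RunParams) (k : ℕ), k ≤ p.K →
          ∀ V ∈ domAltOfRecord F N θ.ν p.K k, UkExists F N p.K k θ.εbg V ∧ UniqueUkOrbit F N p.K k θ.εbg V)
    (hres : ∀ (F : T4Family) (D : Datum F N) (w : WorldP), IsRecordOfRecord₁₁C F N D w →
      ∀ θ : Stage11Params F N, ∀ h : θ.Provisos₁₁, θ.Admissible → D = datumOfRecord₁₁ F N θ h → w.γ ≤ θ.γ →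
        ∀ (p : B12.RunParams) (k : ℕ), k ≤ p.K → HRestrict F N θ.εbg p.K k (domAltOfRecord F N θ.ν p.K k))
    (huniq : ∀ (F : T4Family) (D : Datum F N) (w : WorldP), IsRecordOfRecord₁₁C F N D w →
      ∀ θ : Stage11Params F N, ∀ h : θ.Provisos₁₁, θ.Admissible → D = datumOfRecord₁₁ F N θ h → w.γ ≤ θ.γ →
        ∀ (p : B12.RunParams) (k : ℕ), k ≤ p.K → ∀ V ∈ domAltOfRecord F N θ.ν p.K k, ∀ j < k,
          UniqueUkOrbit F N p.K (j + 1) θ.εbg (Averaging.iter (avOfRecord F N p.K) (j + 1) (Uk F N p.K k θ.εbg V))) :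
    S_N09 (fun F D w => IsRecordOfRecord₁₁C F N D w) :=
  s_N09_of_refines₁₁C _ (fun _ _ _ h => h) slot12 h11 hres huniq

/-- **`S_N09` AT node00-def's FOUR-PIN STAGE-11 RECORD `IsRecordOfRecord₁₁CB10YZW`** ([B10] ∕ [B9] ∕ [B11] ∕ [IV] groups pinned; same datum, same world as a ₁₁C
record: `Node00.isRecordOfRecord₁₁C_of_isRecordOfRecord₁₁CB10YZW`), from the same slot and binders over the ₁₁C presentation. [cite: Balaban1987RG1, Lemma 4 (3.53) p.280 and Thm 3 p.264; Balaban1985Variational, Thm 1 p.279] -/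
theorem s_N09_rec₁₁CB10YZW
    (slot12 : ∀ (F : T4Family) (D : Datum F N) (w : WorldP), IsRecordOfRecord₁₁CB10YZW F N D w →
      ∀ θ : Stage11Params F N, ∀ h : θ.Provisos₁₁, θ.Admissible → D = datumOfRecord₁₁ F N θ h → w.γ ≤ θ.γ →
        (∀ P, w.up P = upOfRecord₅C F N (θ.toStage5₁₁ F N) P) → ∀ P : B12.RunParams, B12Sec2to5.Lemma4Printed (θ.res.X P).F12 (θ.res.X P).c12)
    (h11 : ∀ (F : T4Family) (D : Datum F N) (w : WorldP), IsRecordOfRecord₁₁CB10YZW F N D w →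
      ∀ θ : Stage11Params F N, ∀ h : θ.Provisos₁₁, θ.Admissible → D = datumOfRecord₁₁ F N θ h → w.γ ≤ θ.γ →
        ∀ (p : B12.RunParams) (k : ℕ), k ≤ p.K →
          ∀ V ∈ domAltOfRecord F N θ.ν p.K k, UkExists F N p.K k θ.εbg V ∧ UniqueUkOrbit F N p.K k θ.εbg V)
    (hres : ∀ (F : T4Family) (D : Datum F N) (w : WorldP), IsRecordOfRecord₁₁CB10YZW F N D w →
      ∀ θ : Stage11Params F N, ∀ h : θ.Provisos₁₁, θ.Admissible → D = datumOfRecord₁₁ F N θ h → w.γ ≤ θ.γ →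
        ∀ (p : B12.RunParams) (k : ℕ), k ≤ p.K → HRestrict F N θ.εbg p.K k (domAltOfRecord F N θ.ν p.K k))
    (huniq : ∀ (F : T4Family) (D : Datum F N) (w : WorldP), IsRecordOfRecord₁₁CB10YZW F N D w →
      ∀ θ : Stage11Params F N, ∀ h : θ.Provisos₁₁, θ.Admissible → D = datumOfRecord₁₁ F N θ h → w.γ ≤ θ.γ →
        ∀ (p : B12.RunParams) (k : ℕ), k ≤ p.K → ∀ V ∈ domAltOfRecord F N θ.ν p.K k, ∀ j < k,
          UniqueUkOrbit F N p.K (j + 1) θ.εbg (Averaging.iter (avOfRecord F N p.K) (j + 1) (Uk F N p.K k θ.εbg V))) :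
    S_N09 (fun F D w => IsRecordOfRecord₁₁CB10YZW F N D w) :=
  s_N09_of_refines₁₁C _ (fun _ _ _ h => isRecordOfRecord₁₁C_of_isRecordOfRecord₁₁CB10YZW h) slot12 h11 hres huniq

/-! ## §3. Guards and the node's shape at ₁₁C (transferred from ₅C along the shadow); the `Nodes`-conjunct form at ONE record -/

section Guards11

variable {F : T4Family} {D : FiniteEpsData F (Node00.SU N)} {w : WorldP}

/-- **In-edge guards at every run of a Stage-11 record**: `b4 b5 b6 b7` HOLD (the ₅C guards transferred by `Node00.atWorld_of_isRecordOfRecord₁₁C`).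
[cite: Balaban1985Averaging, Props. 1–10 pp.26–50 (bookkeeping, transferred)] -/
theorem guards_of_isRecordOfRecord₁₁C (h : IsRecordOfRecord₁₁C F N D w) (P : B12.RunParams) :
    (leavesP w P).b4 ∧ (leavesP w P).b5 ∧ (leavesP w P).b6 ∧ (leavesP w P).b7 :=
  atWorld_of_isRecordOfRecord₁₁C (X := fun ℓ => ℓ.b4 ∧ ℓ.b5 ∧ ℓ.b6 ∧ ℓ.b7) (fun _ _ h5 P => guards_of_isRecordOfRecord₅C h5 P) h P

/-- **At a ₁₁C record N09 IS «b8 → b9 → b10 → b11 → (b12 ∧ member)»** (the four discharged in-edges drop out; transferred from ₅C).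
[cite: Balaban1987RG1, Lemma 4 (3.53) p.280 and Thm 3 p.264 (bookkeeping, transferred)] -/
theorem b12_main_iff_of_isRecordOfRecord₁₁C (h : IsRecordOfRecord₁₁C F N D w) (P : B12.RunParams) :
    Dag.B12_main (leavesP w P) ↔
      ((leavesP w P).b8 → (leavesP w P).b9 → (leavesP w P).b10 → (leavesP w P).b11 →
        ((leavesP w P).b12 ∧ ((leavesP w P).b12 → (leavesP w P).b13 → ((leavesP w P).smallCouplings → (leavesP w P).smallFieldInductive)))) :=
  atWorld_of_isRecordOfRecord₁₁C
    (X := fun ℓ => Dag.B12_main ℓ ↔ (ℓ.b8 → ℓ.b9 → ℓ.b10 → ℓ.b11 → (ℓ.b12 ∧ (ℓ.b12 → ℓ.b13 → (ℓ.smallCouplings → ℓ.smallFieldInductive)))))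
    (fun _ _ h5 P => b12_main_iff_of_isRecordOfRecord₅C h5 P) h P

/-- **N09's `Nodes`-CONJUNCT AT ONE STAGE-11 RECORD `(D, w)`** — `∀ P, Dag.B12_main (leavesP w P)` from the pin slot and the [B11] binders stated AT THIS record's
presenting parameters (the shape K1's ∃-form `StabilityBAtRecordR11e` consumes through `Node00.endStatementBPrinted_of_isRecordOfRecord₁₁C_of_nodes`; MODULE 3′'s
`b12_main_at_record₁₁C_of_leaf` BY NAME). [cite: Balaban1987RG1, Lemma 4 (3.53) p.280, Thm 1 p.259 and Thm 3 p.264; Balaban1985Variational, Thm 1 p.279] -/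
theorem forall_b12_main_of_isRecordOfRecord₁₁C (h : IsRecordOfRecord₁₁C F N D w)
    (slot12 : ∀ θ : Stage11Params F N, ∀ hP : θ.Provisos₁₁, θ.Admissible → D = datumOfRecord₁₁ F N θ hP → w.γ ≤ θ.γ →
      (∀ P, w.up P = upOfRecord₅C F N (θ.toStage5₁₁ F N) P) → ∀ P, B12Sec2to5.Lemma4Printed (θ.res.X P).F12 (θ.res.X P).c12)
    (h11 : ∀ θ : Stage11Params F N, ∀ hP : θ.Provisos₁₁, θ.Admissible → D = datumOfRecord₁₁ F N θ hP → w.γ ≤ θ.γ →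
      ∀ (p : B12.RunParams) (k : ℕ), k ≤ p.K →
        ∀ V ∈ domAltOfRecord F N θ.ν p.K k, UkExists F N p.K k θ.εbg V ∧ UniqueUkOrbit F N p.K k θ.εbg V)
    (hres : ∀ θ : Stage11Params F N, ∀ hP : θ.Provisos₁₁, θ.Admissible → D = datumOfRecord₁₁ F N θ hP → w.γ ≤ θ.γ →
      ∀ (p : B12.RunParams) (k : ℕ), k ≤ p.K → HRestrict F N θ.εbg p.K k (domAltOfRecord F N θ.ν p.K k))
    (huniq : ∀ θ : Stage11Params F N, ∀ hP : θ.Provisos₁₁, θ.Admissible → D = datumOfRecord₁₁ F N θ hP → w.γ ≤ θ.γ →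
      ∀ (p : B12.RunParams) (k : ℕ), k ≤ p.K → ∀ V ∈ domAltOfRecord F N θ.ν p.K k, ∀ j < k,
        UniqueUkOrbit F N p.K (j + 1) θ.εbg (Averaging.iter (avOfRecord F N p.K) (j + 1) (Uk F N p.K k θ.εbg V))) :
    ∀ P : B12.RunParams, Dag.B12_main (leavesP w P) :=
  fun P => B12NodeKnitRecord11.b12_main_at_record₁₁C_of_leaf h slot12 h11 hres huniq P

end Guards11

end Summit.QuantumFields.YangMills.BalabanUVNodes.N09AtRecord11

end
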